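import Summits.RiemannHypothesis.RiemannHypothesis.Theorems.SemilocalPiecewiseIncrementSum
import Summits.RiemannHypothesis.RiemannHypothesis.Theorems.SemilocalArchDensityFar
import HarnessLib

/-!
# Semi-local thresholds, negative side (IVd): PIECEWISE polynomial Markov witnesses, part 3 — the certificate `WeilNegCertPW`

Cell `rh-explicit` (HOME `run/shared/lean/pub/rh-explicit/`), seat cc-s2-4 gen8 (kernel column of the A4 SEMILOCAL-TABLE; fourth file of
the PIECEWISE-witness layer of `HOME/cc-s2-4/CC4-LEAN.md` §13.6).  Honest framing: theorems about the tree's `weilSemilocalThreshold S`;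
nothing here bears on RH.  No data is trusted.

Data: the pieces `P` (inside `[0, b]`, interiors disjoint), enclosure orders, the atom table with, for each atom, the INDEX of the
`t`-piece containing its enclosure `[lo, hi]`, the `t`-cuts `0 < T₁ < … < T_r = 2b` (containing every switch point of the
cross terms, so that `pwIncrementL P T_i T_{i+1}` is `some D_i` on every piece), claimed rational bounds `B_i` of the piece integrals
`∫_{(T_i,T_{i+1}]} w·D` and `A` of the atom side.  Kernel facts: `checkMainPW c₀` (side conditions, `b ≤ 4`, final inequality
`A + Σ B_i + 4N·T < (c₀ + 2Σ wlo)·2N` — no polar credit), `checkAtomsPW` (`Σ whi·U(D_{k}) ≤ A`), `checkPiecePW i` (piece `0`: `D_0 = t·q`,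
`pieceWQ`; pieces `i ≥ 1`: `pieceFarQ`, `SemilocalArchDensityFar.lean`).  SOUNDNESS `weilSemilocalThreshold_le_of_checkPW[_sharp]`:
`AtomsEnclose S N c.atoms c.logSuccLo → checkMainPW → checkAtomsPW → (∀ i < r, checkPiecePW i) → a*(S) ≤ c.b`.  Folklore throughout.
-/

set_option autoImplicit false
set_option linter.dupNamespace false  -- the mandated namespace repeats `RiemannHypothesis`

noncomputable section

open Complex Filter Set MeasureTheory Topology
open scoped Real

namespace Summit.RiemannHypothesis.RiemannHypothesis.Theorems.SemilocalPolyWitness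

open MeasureTheory Set Finset Real
open Literature.NumberTheory.LFunctions
open Summit.RiemannHypothesis.RiemannHypothesis.Theorems.MotivicDoor
open Summit.RiemannHypothesis.RiemannHypothesis.Theorems.MotivicDoor.SemilocalThreshold
open Summit.RiemannHypothesis.RiemannHypothesis.Theorems.MotivicDoor.SemilocalMarkov
open LQ

/-! ## The certificate -/

/-- A piecewise negative certificate. -/
structure WeilNegCertPW where
  /-- the pieces of `F` on `[0, b]` (the witness is `F(x) − F(−x)`) -/
  P : List Pw
  /-- the window half-width (`a*(S) ≤ b` is the conclusion) -/
  b : ℚ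
  /-- order of the `exp` majorant (`≥ 1`) -/
  nA : ℕ
  /-- half the number of geometric terms in the centred majorant -/
  mA : ℕ
  /-- order of the `sinh` minorant -/
  KA : ℕ
  /-- half the number of geometric terms in the `1/t` majorant (far pieces) -/
  mF : ℕ
  /-- number of explicit tail exponentials -/
  Kt : ℕ
  /-- order of the partial `exp` sums bounding `e^{−x}` (`≥ 1`) -/
  nt : ℕ
  /-- the atoms `(n, lo, hi, wlo, whi)` -/
  atoms : List (ℕ × AtomQ)
  /-- for each atom, the index of the `t`-piece containing `[lo, hi]` -/
  atomPiece : List ℕ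
  /-- a rational lower bound of `log (N+1)` -/
  logSuccLo : ℚ
  /-- the cuts `T₁ < … < T_r = 2b` of the bulk `(0, 2b]` -/
  cuts : List ℚ
  /-- claimed bounds `B_i ≥ ∫_{(T_i, T_{i+1}]} w·D` -/
  pieceB : List ℚ
  /-- claimed bound `A ≥ Σ_atoms whi·U` -/
  atomB : ℚ

namespace WeilNegCertPW

variable (c : WeilNegCertPW)

/-- Left end of piece `i` (`T₀ = 0`). -/
def T0 (i : ℕ) : ℚ := (0 :: c.cuts).getD i 0
/-- Right end of piece `i`. -/
def T1 (i : ℕ) : ℚ := c.cuts.getD i 0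

/-- The increment list on piece `i` (or `none`). -/
def D (i : ℕ) : Option (List ℚ) := pwIncrementL c.P (c.T0 i) (c.T1 i)

/-- `N_F = Σ ∫ p_k²` (`‖G‖² = 2 N_F`). -/
def NF : ℚ := pwNormSqF c.P

/-- Kernel fact `i`: the `i`-th piece integral is at most the claimed `B_i` (piece `0` through `D₀ = t·q₀` and the wide centred
majorant of `t·w`; later pieces through the far majorant of `w`). -/
def checkPiecePW (i : ℕ) : Bool :=
  match c.D i with
  | none => false
  | some Di =>
      if i = 0 then decide (Di.headD 0 = 0) && decide (pieceWQ c.nA c.mA c.KA Di.tail 0 (c.T1 0) ≤ c.pieceB.getD 0 0)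
      else decide (pieceFarQ c.nA c.mA c.KA c.mF Di (c.T0 i) (c.T1 i) ≤ c.pieceB.getD i 0)

/-- The atom side with per-atom piece indices: `Σ whi·U_[lo,hi](D_k)`, or `none` if an atom does not fit its piece. -/
def atomLhsPW : List (ℕ × AtomQ) → List ℕ → Option ℚ
  | [], _ => some 0
  | _ :: _, [] => none
  | na :: rest, k :: ks =>
      match c.D k, atomLhsPW rest ks with
      | some Dk, some A =>
          if c.T0 k ≤ na.2.lo ∧ na.2.hi ≤ c.T1 k then some (na.2.whi * evalUpperQ Dk na.2.lo (na.2.hi - na.2.lo) + A)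
          else none
      | _, _ => none

/-- Kernel fact: the atom side is at most the claimed `A`. -/
def checkAtomsPW : Bool :=
  match c.atomLhsPW c.atoms c.atomPiece with
  | some A => decide (A ≤ c.atomB)
  | none => false

/-- Lower bound of the right side WITHOUT polar credit, given `c₀ ≤ C_∅`. -/
def rhsPW (c0 : ℚ) : ℚ := (c0 + 2 * atomWloSum c.atoms) * (2 * c.NF)

/-- Kernel fact: side conditions and the final strict inequality from the CLAIMED bounds. -/
def checkMainPW (c0 : ℚ) : Bool :=
  pwInside c.b c.P && pwDisjoint c.P && decide (0 < c.b) && decide (c.b ≤ 4) &&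
    decide (0 < c.nA) && decide (0 < c.nt) && decide (invPartialExpQ c.nt (2 * (2 * c.b)) < 1) &&
    atomsOk (2 * c.b) c.atoms && decide (2 * c.b < c.logSuccLo) &&
    cutsOk 0 c.cuts && decide (lastCut 0 c.cuts = 2 * c.b) && decide (c.pieceB.length = c.cuts.length) &&
    decide (c.atomB + sumQ c.pieceB + 2 * (2 * c.NF) * archTailQ (2 * c.b) c.Kt c.nt < c.rhsPW c0)

end WeilNegCertPW

/-! ## Soundness -/

/-- The atom energy bound from `atomLhsPW`. -/
theorem atoms_sum_le_atomLhsPW (c : WeilNegCertPW) {S : Finset ℕ} {G : ℝ → ℂ}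
    (hD : ∀ (k : ℕ) (Dk : List ℚ), c.D k = some Dk → ∀ t ∈ Icc ((c.T0 k : ℚ) : ℝ) (c.T1 k), weilIncrement G t = ev Dk t) :
    ∀ (atoms : List (ℕ × AtomQ)) (ks : List ℕ) (A : ℚ), c.atomLhsPW atoms ks = some A →
      (∀ na ∈ atoms, weilSemilocalCoeff S na.1 ≤ (na.2.whi : ℝ)) →
      (∀ na ∈ atoms, (na.2.lo : ℝ) ≤ Real.log na.1 ∧ Real.log na.1 ≤ (na.2.hi : ℝ)) →
      (atoms.map fun na ↦ weilSemilocalCoeff S na.1 * weilIncrement G (Real.log na.1)).sum ≤ (A : ℝ)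
  | [], _, A, h, _, _ => by simp [WeilNegCertPW.atomLhsPW] at h; subst h; simp
  | _ :: _, [], A, h, _, _ => by simp [WeilNegCertPW.atomLhsPW] at h
  | na :: rest, k :: ks, A, h, hw, hencl => by
      simp only [WeilNegCertPW.atomLhsPW] at h
      cases hDk : c.D k with
      | none => simp [hDk] at h
      | some Dk =>
        cases hA : c.atomLhsPW rest ks with
        | none => simp [hDk, hA] at h
        | some A' =>
          simp only [hDk, hA] at h
          split_ifs at h with hfit
          cases h
          simp only [List.map_cons, List.sum_cons]
          push_cast
          have ih := atoms_sum_le_atomLhsPW c hD rest ks A' hA (fun x hx ↦ hw x (by simp [hx]))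
            (fun x hx ↦ hencl x (by simp [hx]))
          obtain ⟨hlo, hhi⟩ := hencl na (by simp)
          have hfit0 : ((c.T0 k : ℚ) : ℝ) ≤ na.2.lo := by exact_mod_cast hfit.1
          have hfit1 : (na.2.hi : ℝ) ≤ ((c.T1 k : ℚ) : ℝ) := by exact_mod_cast hfit.2
          have hmem : Real.log na.1 ∈ Icc ((c.T0 k : ℚ) : ℝ) (c.T1 k) := ⟨hfit0.trans hlo, hhi.trans hfit1⟩
          have hDv := hD k Dk hDk _ hmem
          have hU : weilIncrement G (Real.log na.1) ≤ (evalUpperQ Dk na.2.lo (na.2.hi - na.2.lo) : ℝ) := by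
            rw [hDv]; exact ev_le_evalUpperQ Dk hlo (by push_cast; linarith)
          have h1 : weilSemilocalCoeff S na.1 * weilIncrement G (Real.log na.1) ≤
              (na.2.whi : ℝ) * evalUpperQ Dk na.2.lo (na.2.hi - na.2.lo) :=
            mul_le_mul (hw na (by simp)) hU (weilIncrement_nonneg _ _)
              ((weilSemilocalCoeff_nonneg S na.1).trans (hw na (by simp)))
          linarith

/-- **The bulk over the pieces of a piecewise certificate** (induction on the cut list; piece `j` counted from index `i₀`). -/
theorem piecesPW_bound (c : WeilNegCertPW) {G : ℝ → ℂ}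
    (hD : ∀ (k : ℕ) (Dk : List ℚ), c.D k = some Dk → ∀ t ∈ Icc ((c.T0 k : ℚ) : ℝ) (c.T1 k), weilIncrement G t = ev Dk t)
    (hpiece : ∀ i, i < c.cuts.length →
      IntegrableOn (fun t ↦ weilArchDensity t * weilIncrement G t) (Ioc ((c.T0 i : ℚ) : ℝ) (c.T1 i)) ∧
        ∫ t in Ioc ((c.T0 i : ℚ) : ℝ) (c.T1 i), weilArchDensity t * weilIncrement G t ≤ (c.pieceB.getD i 0 : ℝ)) :
    ∀ (i0 : ℕ) (T : ℚ) (rest B : List ℚ), (∀ j, j < rest.length → (T :: rest).getD j 0 = c.T0 (i0 + j) ∧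
        rest.getD j 0 = c.T1 (i0 + j) ∧ B.getD j 0 = c.pieceB.getD (i0 + j) 0 ∧ i0 + j < c.cuts.length) →
      cutsOk T rest = true → B.length = rest.length →
      IntegrableOn (fun t ↦ weilArchDensity t * weilIncrement G t) (Ioc (T : ℝ) (lastCut T rest)) ∧
        ∫ t in Ioc (T : ℝ) (lastCut T rest), weilArchDensity t * weilIncrement G t ≤ ((sumQ B : ℚ) : ℝ)
  | i0, T, [], B, _, _, hlen => by
      have hB : B = [] := List.length_eq_zero_iff.1 (by simpa using hlen)
      subst hB; simp [lastCut, sumQ]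
  | i0, T, T1 :: rest, B, hidx, hcuts, hlen => by
      obtain ⟨B0, Brest, rfl⟩ : ∃ B0 Brest, B = B0 :: Brest := by
        cases B with
        | nil => simp at hlen
        | cons a l => exact ⟨a, l, rfl⟩
      simp only [cutsOk, Bool.and_eq_true, decide_eq_true_eq] at hcuts
      obtain ⟨h01, hrest⟩ := hcuts
      simp only [lastCut]
      have hlen' : Brest.length = rest.length := by simpa using hlen
      have h0 := hidx 0 (by simp)
      simp only [List.getD_cons_zero, add_zero] at h0
      obtain ⟨hT0, hT1, hB0, hi0⟩ := h0
      -- the first piece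
      have hp := hpiece i0 hi0
      rw [← hT0, ← hT1, ← hB0] at hp
      -- the rest (indices shifted by one)
      have hrec := piecesPW_bound c hD hpiece (i0 + 1) T1 rest Brest (fun j hj ↦ by
        have := hidx (j + 1) (by simpa using hj)
        simp only [List.getD_cons_succ] at this
        rw [show i0 + 1 + j = i0 + (j + 1) by ring]
        exact this) hrest hlen'
      have hT1last : (T1 : ℝ) ≤ lastCut T1 rest := by exact_mod_cast le_lastCut T1 rest hrest
      have hT01' : (T : ℝ) ≤ T1 := by exact_mod_cast h01.le
      have hunion : Ioc (T : ℝ) T1 ∪ Ioc (T1 : ℝ) (lastCut T1 rest) = Ioc (T : ℝ) (lastCut T1 rest) :=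
        Ioc_union_Ioc_eq_Ioc hT01' hT1last
      rw [← hunion]
      refine ⟨hp.1.union hrec.1, ?_⟩
      rw [setIntegral_union (Ioc_disjoint_Ioc_of_le le_rfl) measurableSet_Ioc hp.1 hrec.1, sumQ]
      push_cast
      linarith [hp.2, hrec.2]

/-- **SOUNDNESS of the piecewise certificate.** -/
theorem weilSemilocalThreshold_le_of_checkPW (c : WeilNegCertPW) {S : Finset ℕ} {N : ℕ} {c0 : ℚ}
    (henc : AtomsEnclose S N c.atoms c.logSuccLo) (hc0 : (c0 : ℝ) ≤ semilocalEmptyConstant)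
    (hmain : c.checkMainPW c0 = true) (hat : c.checkAtomsPW = true)
    (hpieces : ∀ i, i < c.cuts.length → c.checkPiecePW i = true) :
    weilSemilocalThreshold S ≤ (c.b : ℝ) := by
  simp only [WeilNegCertPW.checkMainPW, Bool.and_eq_true, decide_eq_true_eq] at hmain
  obtain ⟨⟨⟨⟨⟨⟨⟨⟨⟨⟨⟨⟨hin, hdisj⟩, hb0⟩, hb4⟩, hnA⟩, hnt⟩, htail1⟩, hatoms⟩, hsucc⟩, hcuts⟩, hlast⟩, hlen⟩,
    hfinal⟩ := hmain
  rw [atomsOk_iff] at hatoms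
  obtain ⟨hnodup, hsub, hcover, hencl, hlogSucc⟩ := henc
  set b := c.b
  have hb0' : (0 : ℝ) < b := by exact_mod_cast hb0
  have hbwin : (b : ℝ) < Real.log ((N : ℝ) + 1) / 2 := by
    have h1 : ((2 * b : ℚ) : ℝ) < c.logSuccLo := by exact_mod_cast hsucc
    push_cast at h1
    linarith
  set G := pwWitness c.P with hG
  have hW := isMarkovWitness_pwWitness hin hb0
  set Nm : ℝ := 2 * (pwNormSqF c.P : ℝ)
  have hN : ∫ x, ‖G x‖ ^ 2 = Nm := integral_norm_sq_pwWitness hin hdisj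
  have hN0 : 0 ≤ Nm := by rw [← hN]; exact integral_nonneg fun x ↦ by positivity
  -- D on the pieces
  have hT0nn : ∀ k, 0 ≤ c.T0 k := by
    intro k
    cases k with
    | zero => simp [WeilNegCertPW.T0]
    | succ k =>
        simp only [WeilNegCertPW.T0, List.getD_cons_succ]
        by_cases hk : k < c.cuts.length
        · exact (cutsOk_lt_getD 0 c.cuts hcuts k hk).le
        · rw [List.getD_eq_default _ _ (not_lt.1 hk)]
  have hDev : ∀ (k : ℕ) (Dk : List ℚ), c.D k = some Dk → ∀ t ∈ Icc ((c.T0 k : ℚ) : ℝ) (c.T1 k),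
      weilIncrement G t = ev Dk t := fun k Dk hk t ht ↦
    weilIncrement_pwWitness_eq hin hdisj hb0 hk (hT0nn k) ht
  -- atoms
  have hAt : semilocalAtomEnergy S N G ≤ (c.atomB : ℝ) := by
    unfold semilocalAtomEnergy
    rw [sum_range_eq_atoms_sum (h := fun n ↦ weilSemilocalCoeff S n * weilIncrement G (Real.log n)) hnodup hsub
      (fun n hn hnot ↦ by rw [hcover n hn hnot, zero_mul])]
    simp only [WeilNegCertPW.checkAtomsPW] at hat
    cases hA : c.atomLhsPW c.atoms c.atomPiece with
    | none => simp [hA] at hat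
    | some A =>
      simp only [hA, decide_eq_true_eq] at hat
      refine (atoms_sum_le_atomLhsPW c hDev c.atoms c.atomPiece A hA (fun na hna ↦ (hencl na hna).2.2.2)
        (fun na hna ↦ ⟨(hencl na hna).1, (hencl na hna).2.1⟩)).trans (by exact_mod_cast hat)
  -- each piece
  have h8 : ∀ i, i < c.cuts.length → ((c.T1 i : ℚ) : ℝ) ≤ 8 := by
    intro i hi
    have hle : c.T1 i ≤ lastCut 0 c.cuts := cutsOk_getD_le_lastCut 0 c.cuts hcuts i hi
    rw [hlast] at hle
    have : ((c.T1 i : ℚ) : ℝ) ≤ ((2 * b : ℚ) : ℝ) := by exact_mod_cast hle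
    push_cast at this
    have hb4' : (b : ℝ) ≤ 4 := by exact_mod_cast hb4
    linarith
  have hT01 : ∀ i, i < c.cuts.length → c.T0 i < c.T1 i := fun i hi ↦ cutsOk_cons_getD_lt 0 c.cuts hcuts i hi
  have hpiece : ∀ i, i < c.cuts.length →
      IntegrableOn (fun t ↦ weilArchDensity t * weilIncrement G t) (Ioc ((c.T0 i : ℚ) : ℝ) (c.T1 i)) ∧
        ∫ t in Ioc ((c.T0 i : ℚ) : ℝ) (c.T1 i), weilArchDensity t * weilIncrement G t ≤ (c.pieceB.getD i 0 : ℝ) := by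
    intro i hi
    have hci := hpieces i hi
    simp only [WeilNegCertPW.checkPiecePW] at hci
    cases hDi : c.D i with
    | none => simp [hDi] at hci
    | some Di =>
      simp only [hDi] at hci
      have hDI : ∀ t ∈ Ioc ((c.T0 i : ℚ) : ℝ) (c.T1 i), weilIncrement G t = ev Di t := fun t ht ↦
        hDev i Di hDi t ⟨ht.1.le, ht.2⟩
      have hnn : ∀ t ∈ Ioc ((c.T0 i : ℚ) : ℝ) (c.T1 i), 0 ≤ ev Di t := fun t ht ↦ by
        rw [← hDI t ht]; exact weilIncrement_nonneg G t
      split_ifs at hci with hi0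
      · -- the first piece: D₀ = t·q₀, centred wide majorant
        simp only [Bool.and_eq_true, decide_eq_true_eq] at hci
        obtain ⟨hhead, hB⟩ := hci
        subst hi0
        have hT00 : c.T0 0 = 0 := by simp [WeilNegCertPW.T0]
        rw [hT00] at hDI hnn ⊢
        have hDq : ∀ t ∈ Ioc ((0 : ℚ) : ℝ) (c.T1 0), weilIncrement G t = t * ev Di.tail t := fun t ht ↦ by
          rw [hDI t ht, ev_eq_headD_add_tail, hhead]; push_cast; ring
        have hq : ∀ t ∈ Ioc ((0 : ℚ) : ℝ) (c.T1 0), 0 ≤ ev Di.tail t := fun t ht ↦ by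
          have h1 := weilIncrement_nonneg G t
          rw [hDq t ht] at h1
          have ht0 : (0 : ℝ) < t := by exact_mod_cast ht.1
          exact (mul_nonneg_iff_of_pos_left ht0).1 h1
        have h01 : (0 : ℚ) < c.T1 0 := by have := hT01 0 hi; rwa [hT00] at this
        have hres := setIntegral_weilArchDensity_mul_le_pieceW (q := Di.tail) (D := weilIncrement G) le_rfl h01 (h8 0 hi)
          (fun t ht ↦ hDq t (by exact_mod_cast ht)) (fun t ht ↦ hq t (by exact_mod_cast ht)) c.nA c.mA c.KA hnA
        push_cast at hres ⊢
        exact ⟨hres.1, hres.2.trans (by exact_mod_cast hB)⟩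
      · -- a far piece
        simp only [decide_eq_true_eq] at hci
        have hT0pos : 0 < c.T0 i := by
          cases i with
          | zero => exact absurd rfl hi0
          | succ i =>
              simp only [WeilNegCertPW.T0, List.getD_cons_succ]
              have := hT01 i (by omega)
              have h0 := hT0nn i
              exact lt_of_le_of_lt h0 this
        have hres := setIntegral_weilArchDensity_mul_le_pieceFar (D := Di) (Dfun := weilIncrement G) hT0pos (hT01 i hi)
          (h8 i hi) hDI hnn c.nA c.mA c.KA c.mF hnA
        exact ⟨hres.1, hres.2.trans (by exact_mod_cast hci)⟩
  -- bulk over all pieces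
  have hbulk := piecesPW_bound c hDev hpiece 0 0 c.cuts c.pieceB (fun j hj ↦ by
    simp [WeilNegCertPW.T0, WeilNegCertPW.T1, hj]) hcuts hlen
  have hlastR : ((lastCut 0 c.cuts : ℚ) : ℝ) = ((2 * b : ℚ) : ℝ) := by rw [hlast]
  rw [show ((0 : ℚ) : ℝ) = 0 by norm_num, hlastR] at hbulk
  push_cast at hbulk
  obtain ⟨hintA, hA⟩ := hbulk
  have hintA' : IntegrableOn (fun t ↦ weilArchDensity t * weilIncrement G t) (Set.Ioc (0 : ℝ) ((2 * b : ℚ) : ℝ)) := by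
    push_cast; exact hintA
  -- tail
  have h2b0 : (0 : ℚ) < 2 * b := by positivity
  obtain ⟨hintW, _⟩ := setIntegral_Ioi_weilArchDensity_le c.Kt (c := ((2 * b : ℚ) : ℝ)) (by exact_mod_cast h2b0)
  have hT := setIntegral_Ioi_weilArchDensity_le_archTailQ c.Kt hnt h2b0 htail1
  have hDtail : EqOn (fun t ↦ weilArchDensity t * weilIncrement G t) (fun t ↦ 2 * Nm * weilArchDensity t)
      (Set.Ioi ((2 * b : ℚ) : ℝ)) := fun t ht ↦ by
    simp only
    rw [weilIncrement_pwWitness_eq_of_lt hin hdisj hb0 (by push_cast at ht; exact ht)]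
    ring
  have hintW' : IntegrableOn (fun t ↦ 2 * Nm * weilArchDensity t) (Set.Ioi ((2 * b : ℚ) : ℝ)) :=
    hintW.const_mul (2 * Nm)
  have hintT : IntegrableOn (fun t ↦ weilArchDensity t * weilIncrement G t) (Set.Ioi ((2 * b : ℚ) : ℝ)) :=
    hintW'.congr_fun hDtail.symm measurableSet_Ioi
  have hTail : ∫ t in Set.Ioi ((2 * b : ℚ) : ℝ), weilArchDensity t * weilIncrement G t ≤
      2 * Nm * archTailQ (2 * b) c.Kt c.nt := by
    rw [setIntegral_congr_fun measurableSet_Ioi hDtail, integral_const_mul]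
    exact mul_le_mul_of_nonneg_left hT (by positivity)
  have hunion : Set.Ioc (0 : ℝ) ((2 * b : ℚ) : ℝ) ∪ Set.Ioi ((2 * b : ℚ) : ℝ) = Set.Ioi (0 : ℝ) :=
    Set.Ioc_union_Ioi_eq_Ioi (by exact_mod_cast h2b0.le)
  have hfin : IntegrableOn (fun t ↦ weilArchDensity t * weilIncrement G t) (Set.Ioi (0 : ℝ)) := by
    rw [← hunion]; exact hintA'.union hintT
  have hInt : ∫ t in Set.Ioi (0 : ℝ), weilArchDensity t * weilIncrement G t
      ≤ (sumQ c.pieceB : ℝ) + 2 * Nm * archTailQ (2 * b) c.Kt c.nt := by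
    rw [← hunion, setIntegral_union Ioc_disjoint_Ioi_same measurableSet_Ioi hintA' hintT]
    refine add_le_add ?_ hTail
    push_cast; exact hA
  have hpol : (0 : ℝ) ≤ ‖weilMellin G 1‖ ^ 2 := by positivity
  have hCS : (c0 : ℝ) + 2 * atomWloSum c.atoms ≤ semilocalWindowConstant S N := by
    unfold semilocalWindowConstant semilocalCoeffSum
    rw [sum_range_eq_atoms_sum (h := fun n ↦ weilSemilocalCoeff S n) hnodup hsub hcover]
    have hw := atomWloSum_le c.atoms (fun na hna ↦ (hencl na hna).2.2.1)
    linarith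
  have hfinal' : ((c.atomB + sumQ c.pieceB + 2 * (2 * c.NF) * archTailQ (2 * b) c.Kt c.nt : ℚ) : ℝ) <
      c.rhsPW c0 := by exact_mod_cast hfinal
  simp only [WeilNegCertPW.rhsPW, WeilNegCertPW.NF] at hfinal'
  push_cast at hfinal'
  have hrhs : ((c0 : ℝ) + 2 * atomWloSum c.atoms) * Nm ≤ semilocalWindowConstant S N * (∫ x, ‖G x‖ ^ 2) + 2 * ‖weilMellin G 1‖ ^ 2 := by
    rw [hN]
    have : ((c0 : ℝ) + 2 * atomWloSum c.atoms) * Nm ≤ semilocalWindowConstant S N * Nm :=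
      mul_le_mul_of_nonneg_right hCS hN0
    linarith
  have hlt : semilocalAtomEnergy S N G + (∫ t in Set.Ioi (0 : ℝ), weilArchDensity t * weilIncrement G t) <
      semilocalWindowConstant S N * (∫ x, ‖G x‖ ^ 2) + 2 * ‖weilMellin G 1‖ ^ 2 := by
    have : (c.atomB : ℝ) + ((sumQ c.pieceB : ℝ) + 2 * Nm * archTailQ (2 * b) c.Kt c.nt) <
        ((c0 : ℝ) + 2 * atomWloSum c.atoms) * Nm := by
      simp only [Nm]; linarith
    linarith
  exact weilSemilocalThreshold_le_of_markovWitness_window S N hW hfin hlt hbwin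

/-- Soundness of the piecewise certificate with the sharp constant `c0SharpQ`. -/
theorem weilSemilocalThreshold_le_of_checkPW_sharp (c : WeilNegCertPW) {S : Finset ℕ} {N : ℕ}
    (henc : AtomsEnclose S N c.atoms c.logSuccLo) (hmain : c.checkMainPW c0SharpQ = true)
    (hat : c.checkAtomsPW = true) (hpieces : ∀ i, i < c.cuts.length → c.checkPiecePW i = true) :
    weilSemilocalThreshold S ≤ (c.b : ℝ) :=
  weilSemilocalThreshold_le_of_checkPW c henc c0SharpQ_le hmain hat hpieces

/-! Build note (cc-s2-4 gen11, 2026-08-24): comment-only re-commit of p364651 (accepted 2026-08-23, never built on the hub; lead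
R14-3 APPEND REMEDY) — users: the kinked rows `SemilocalNegCert{TwoThree,TwoThreeFive,Seven,Eleven}Kinked*` (gen8, held) and the
twin-prime walls `SemilocalNegCertUpto{NinetySeven,HundredThree}Kinked*` + `SemilocalPiecewiseCertSplit` (gen11). -/

end Summit.RiemannHypothesis.RiemannHypothesis.Theorems.SemilocalPolyWitness

end
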